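import Summits.HodgeConjecture.CorCM.IrreducibleOddWeightsIsotypicCellsIso
import HarnessLib

/-!
# Isotypic cells, existence I: REPRESENTATIVES OF THE ISOMORPHISM CLASSES — an independent spanning sub-family of
# non-zero irreducibles indexed by `Fin n`; the calculus of equivariant isomorphisms; a pairwise non-embeddable
# system of representatives covering every member of a finite family of irreducibles

COR-CM (cell `pub-hodgecm2`, binder seat `b16` gen 76, count-neutral claim THE ISOTYPIC DECOMPOSITION EXISTS, file
E1 — pure linear algebra; theorems only, no definition, no named fact, no `sorry`).  NEW as organised here, hence
under `Summits/`.  HONEST FRAMING: continuation of gen 70's files I1/I2 (`…IsotypicCells`, `…IsotypicCellsIso`): ONE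
ℚ-space `V` with a family of operators `T_i`; `N` STABLE = `∀ i v, v ∈ N → T_i v ∈ N`; `N` IRREDUCIBLE = every
non-zero stable `W ≤ N` is `N`; an equivariant ISOMORPHISM `N → N′` is a linear `P : V → V` mapping `N` into `N′`,
injective on `N`, onto `N′`, commuting with the `T_i` on `N`; an EMBEDDING drops «onto».  Nothing here mentions CM
fields; `HC_CM` is neither used nor asserted.  PURPOSE: gen 75's multi-class formulas (files M1–M9,
`…MultiClass*`) take the isotypic decomposition of the type vectors as INPUT (reference irreducibles `A_c`
pairwise non-embeddable, embeddings, components); files E1–E4 prove that such data EXIST for every family of slots.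

* §1 **AN INDEPENDENT SPANNING SUB-FAMILY OF NON-ZERO MEMBERS** (`exists_fin_iSupIndep_iSup_eq`): a finite family
  of finite-dimensional stable irreducibles `N_s` has an injective re-indexing `e : Fin n ↪ σ` of NON-ZERO members
  which is INDEPENDENT (`iSupIndep`) with `⨆_k N_{e k} = ⨆_s N_s` (I1 §3's dimension-additive spanning sub-set,
  the zero members discarded, and the dimension criterion for independence).
* §2 **ISO CALCULUS**: the identity (`iso_refl`); composition (`iso_trans`); **an EMBEDDING of a non-zero stable
  `N` into an irreducible `N′` is ONTO** (`onto_of_embed_of_irreducible`: the image is a non-zero stable subspace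
  of `N′`); a non-zero source has a non-zero target (`ne_bot_of_embed`).  Inverses are I2's `exists_inverse_of_iso`.
* §3 **REPRESENTATIVES** (`exists_representatives`): for NON-ZERO stable irreducibles `N_s` (`s ∈ σ` finite) there
  are `rep : Fin n → σ` injective, `cl : σ → Fin n` and isomorphisms `L_s : N_{rep (cl s)} ≅ N_s` such that the
  representatives are PAIRWISE NON-EMBEDDABLE — no linear `P` embeds `N_{rep c}` equivariantly into `N_{rep c′}`
  for `c ≠ c′` (literally the separation hypothesis `hsep` of the multi-class files) — and `cl (rep c) = c`.  Proof:
  a pairwise non-isomorphic sub-set `R ⊆ σ` of MAXIMAL SIZE covers every member (else the member could be added,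
  isomorphism being symmetric by I2), the representative of a member of `R` is itself, and an embedding between
  representatives would be an isomorphism by §2.

## References

* [Serre1977] J.-P. Serre, *Linear Representations of Finite Groups*, GTM 42, §1.4 (complete reducibility), §2.2
  (Schur's lemma), §2.6 (canonical decomposition: isotypic components).
* [Lang2002] S. Lang, *Algebra*, 3rd ed., XVII §1 Prop. 1.1 (Schur) and XVII §2 (semisimple modules).
* [CurtisReiner1962] C. W. Curtis, I. Reiner, *Representation Theory of Finite Groups and Associative Algebras*, §15.
-/

set_option autoImplicit false

noncomputable section

open scoped BigOperators Classical

universe u v w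

namespace Summit.HodgeConjecture.CorCM.IrrOdd

variable {V : Type v} [AddCommGroup V] [Module ℚ V] {ι : Type w} (T : ι → V →ₗ[ℚ] V)

/-! ### §1 An independent spanning sub-family of non-zero members, indexed by `Fin n` -/

/-- **AN INDEPENDENT SPANNING SUB-FAMILY OF NON-ZERO MEMBERS.**  `N_s` (`s ∈ σ` finite) finite-dimensional stable
irreducible subspaces.  Then for some `n` and some INJECTIVE `e : Fin n → σ` every `N_{e k}` is non-zero, the family
`(N_{e k})_k` is INDEPENDENT, and `⨆_k N_{e k} = ⨆_s N_s` (file I1 §3: a sub-set `S` with `Σ_{s∈S} N_s = Σ_s N_s`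
and `dim = Σ_{s∈S} dim N_s`; discard the zero members; dimension-additivity is independence).
[cite: Lang2002, XVII §2] [cite: Serre1977, §1.4] -/
theorem exists_fin_iSupIndep_iSup_eq {σ : Type u} [Fintype σ] {N : σ → Submodule ℚ V}
    [∀ s, FiniteDimensional ℚ (N s)]
    (hNst : ∀ (s : σ) (i : ι) (v : V), v ∈ N s → T i v ∈ N s)
    (hNirr : ∀ (s : σ) (W : Submodule ℚ V), W ≤ N s → W ≠ ⊥ →
      (∀ (i : ι) (v : V), v ∈ W → T i v ∈ W) → W = N s) :
    ∃ (n : ℕ) (e : Fin n → σ), Function.Injective e ∧ (∀ k, N (e k) ≠ ⊥) ∧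
      iSupIndep (fun k => N (e k)) ∧ (⨆ k, N (e k)) = ⨆ s, N s := by
  obtain ⟨S, hSsup, hSdim⟩ := exists_finset_sup_eq_iSup_finrank_eq_sum T hNst hNirr
  -- discard the zero members
  set S' : Finset σ := S.filter fun s => N s ≠ ⊥ with hS'
  have hS'S : S' ⊆ S := Finset.filter_subset _ _
  have hS'sup : S'.sup N = S.sup N := by
    refine le_antisymm (Finset.sup_mono hS'S) (Finset.sup_le fun s hs => ?_)
    by_cases h0 : N s = ⊥
    · rw [h0]
      exact bot_le
    · exact Finset.le_sup (Finset.mem_filter.2 ⟨hs, h0⟩)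
  have hS'dim : ∑ s ∈ S', Module.finrank ℚ (N s) = ∑ s ∈ S, Module.finrank ℚ (N s) := by
    refine Finset.sum_filter_of_ne fun s _ hs => ?_
    intro h0
    apply hs
    rw [h0]
    exact finrank_bot ℚ V
  -- the family over the subtype `S'` is independent by the dimension criterion
  have hsub : (⨆ s : S', N s.1) = S'.sup N := by
    rw [Finset.sup_eq_iSup]
    exact (iSup_subtype (p := fun s => s ∈ S') (f := fun s => N s.1))
  have hind : iSupIndep fun s : S' => N s.1 := by
    refine (finrank_iSup_eq_sum_finrank_iff_iSupIndep (fun s : S' => N s.1)).1 ?_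
    rw [hsub, hS'sup, hSsup, hSdim, ← hS'dim, Finset.sum_coe_sort S' (fun s => Module.finrank ℚ (N s))]
  -- re-index by `Fin n`
  let ε := S'.equivFin
  refine ⟨S'.card, fun k => (ε.symm k).1, fun k k' h => ε.symm.injective (Subtype.ext h),
    fun k => (Finset.mem_filter.1 (ε.symm k).2).2, hind.comp ε.symm.injective, ?_⟩
  rw [ε.symm.surjective.iSup_comp (fun s : S' => N s.1), hsub, hS'sup, hSsup]

/-! ### §2 The calculus of equivariant isomorphisms -/

/-- The identity is an equivariant isomorphism `N → N`. [cite: Serre1977, §2.2] -/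
theorem iso_refl (N : Submodule ℚ V) :
    (∀ v ∈ N, (LinearMap.id : V →ₗ[ℚ] V) v ∈ N) ∧ (∀ v ∈ N, (LinearMap.id : V →ₗ[ℚ] V) v = 0 → v = 0) ∧
      (∀ v' ∈ N, ∃ v ∈ N, (LinearMap.id : V →ₗ[ℚ] V) v = v') ∧
      ∀ (i : ι) (v : V), v ∈ N → (LinearMap.id : V →ₗ[ℚ] V) (T i v) = T i ((LinearMap.id : V →ₗ[ℚ] V) v) :=
  ⟨fun _ hv => hv, fun _ _ h => h, fun v' hv' => ⟨v', hv', rfl⟩, fun _ _ _ => rfl⟩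

/-- **COMPOSITION**: equivariant isomorphisms `P : N → N′`, `P′ : N′ → N″` compose to an equivariant isomorphism
`P′ ∘ P : N → N″`. [cite: Serre1977, §2.2] -/
theorem iso_trans {N N' N'' : Submodule ℚ V} {P P' : V →ₗ[ℚ] V}
    (hPN : ∀ v ∈ N, P v ∈ N') (hPinj : ∀ v ∈ N, P v = 0 → v = 0) (hPsurj : ∀ v' ∈ N', ∃ v ∈ N, P v = v')
    (hPeq : ∀ (i : ι) (v : V), v ∈ N → P (T i v) = T i (P v))
    (hP'N : ∀ v' ∈ N', P' v' ∈ N'') (hP'inj : ∀ v' ∈ N', P' v' = 0 → v' = 0)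
    (hP'surj : ∀ v'' ∈ N'', ∃ v' ∈ N', P' v' = v'')
    (hP'eq : ∀ (i : ι) (v' : V), v' ∈ N' → P' (T i v') = T i (P' v')) :
    (∀ v ∈ N, (P' ∘ₗ P) v ∈ N'') ∧ (∀ v ∈ N, (P' ∘ₗ P) v = 0 → v = 0) ∧
      (∀ v'' ∈ N'', ∃ v ∈ N, (P' ∘ₗ P) v = v'') ∧
      ∀ (i : ι) (v : V), v ∈ N → (P' ∘ₗ P) (T i v) = T i ((P' ∘ₗ P) v) := by
  refine ⟨fun v hv => hP'N _ (hPN v hv), fun v hv h => hPinj v hv (hP'inj _ (hPN v hv) h), fun v'' hv'' => ?_,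
    fun i v hv => ?_⟩
  · obtain ⟨v', hv', rfl⟩ := hP'surj v'' hv''
    obtain ⟨v, hv, rfl⟩ := hPsurj v' hv'
    exact ⟨v, hv, rfl⟩
  · rw [LinearMap.comp_apply, LinearMap.comp_apply, hPeq i v hv, hP'eq i _ (hPN v hv)]

/-- **AN EMBEDDING OF A NON-ZERO STABLE SUBSPACE INTO AN IRREDUCIBLE ONE IS ONTO.**  `N` stable, `N ≠ 0`, `N′`
irreducible; `P` maps `N` into `N′`, is injective on `N` and commutes with the `T_i` on `N`.  Then `P(N) = N′`: the
image is a stable non-zero subspace of `N′`. [cite: Serre1977, §2.2] [cite: Lang2002, XVII §1 Prop. 1.1] -/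
theorem onto_of_embed_of_irreducible {N N' : Submodule ℚ V} (P : V →ₗ[ℚ] V)
    (hNst : ∀ (i : ι) (v : V), v ∈ N → T i v ∈ N) (hN0 : N ≠ ⊥)
    (hN'irr : ∀ W : Submodule ℚ V, W ≤ N' → W ≠ ⊥ → (∀ (i : ι) (v : V), v ∈ W → T i v ∈ W) → W = N')
    (hPN : ∀ v ∈ N, P v ∈ N') (hPinj : ∀ v ∈ N, P v = 0 → v = 0)
    (hPeq : ∀ (i : ι) (v : V), v ∈ N → P (T i v) = T i (P v)) :
    ∀ v' ∈ N', ∃ v ∈ N, P v = v' := by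
  have himage : N.map P = N' := by
    refine hN'irr _ (fun x hx => ?_) ?_ ?_
    · obtain ⟨v, hv, rfl⟩ := Submodule.mem_map.1 hx
      exact hPN v hv
    · intro h
      apply hN0
      rw [eq_bot_iff]
      intro v hv
      have hPv : P v ∈ N.map P := Submodule.mem_map_of_mem hv
      rw [h, Submodule.mem_bot] at hPv
      rw [Submodule.mem_bot]
      exact hPinj v hv hPv
    · intro i x hx
      obtain ⟨v, hv, rfl⟩ := Submodule.mem_map.1 hx
      rw [← hPeq i v hv]
      exact Submodule.mem_map_of_mem (hNst i v hv)
  intro v' hv'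
  rw [← himage] at hv'
  obtain ⟨v, hv, rfl⟩ := Submodule.mem_map.1 hv'
  exact ⟨v, hv, rfl⟩

omit T in
/-- A linear map injective on a non-zero `N` and mapping `N` into `N′` has a non-zero target: `N′ ≠ 0`. [folklore] -/
theorem ne_bot_of_embed {N N' : Submodule ℚ V} (P : V →ₗ[ℚ] V) (hN0 : N ≠ ⊥)
    (hPN : ∀ v ∈ N, P v ∈ N') (hPinj : ∀ v ∈ N, P v = 0 → v = 0) : N' ≠ ⊥ := by
  intro h
  apply hN0
  rw [eq_bot_iff]
  intro v hv
  have hPv := hPN v hv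
  rw [h, Submodule.mem_bot] at hPv
  rw [Submodule.mem_bot]
  exact hPinj v hv hPv

/-- A subspace onto which a zero subspace maps is zero: `N = 0` and `P(N) ⊇ N′` give `N′ = 0`. [folklore] -/
theorem eq_bot_of_onto {N N' : Submodule ℚ V} (P : V →ₗ[ℚ] V) (hN0 : N = ⊥)
    (hPsurj : ∀ v' ∈ N', ∃ v ∈ N, P v = v') : N' = ⊥ := by
  rw [eq_bot_iff]
  intro v' hv'
  obtain ⟨v, hv, rfl⟩ := hPsurj v' hv'
  rw [hN0, Submodule.mem_bot] at hv
  rw [hv, map_zero, Submodule.mem_bot]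

/-! ### §3 Representatives of the isomorphism classes -/

/-- **REPRESENTATIVES OF THE ISOMORPHISM CLASSES.**  `N_s` (`s ∈ σ`, `σ` finite) NON-ZERO stable irreducible
subspaces.  Then there are `n`, an INJECTIVE `rep : Fin n → σ`, a class map `cl : σ → Fin n` with `cl (rep c) = c`,
and linear `L_s : V → V` such that

* the representatives are PAIRWISE NON-EMBEDDABLE: for `c ≠ c′` no linear `P` maps `N_{rep c}` into `N_{rep c′}`
  injectively and equivariantly (the separation hypothesis `hsep` of the multi-class files M1–M9);
* `L_s` is an equivariant ISOMORPHISM `N_{rep (cl s)} → N_s` (into, injective on, onto, commuting with the `T_i`).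

Proof: among the sub-sets of `σ` whose members are pairwise non-isomorphic take one, `R`, of maximal size; every
`N_s` is isomorphic to some `N_r`, `r ∈ R` (otherwise `R ∪ {s}` would qualify, isomorphism being symmetric by
I2's inverses); the representative of a member of `R` is itself; an embedding between representatives is onto by
irreducibility (§2), i.e. an isomorphism, excluded. [cite: Serre1977, §2.2 and §2.6] [cite: Lang2002, XVII §1
Prop. 1.1 and XVII §2] [cite: CurtisReiner1962, §15] -/
theorem exists_representatives {σ : Type u} [Fintype σ] {N : σ → Submodule ℚ V}
    (hNst : ∀ (s : σ) (i : ι) (v : V), v ∈ N s → T i v ∈ N s)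
    (hNirr : ∀ (s : σ) (W : Submodule ℚ V), W ≤ N s → W ≠ ⊥ →
      (∀ (i : ι) (v : V), v ∈ W → T i v ∈ W) → W = N s)
    (hN0 : ∀ s, N s ≠ ⊥) :
    ∃ (n : ℕ) (rep : Fin n → σ) (cl : σ → Fin n) (L : σ → (V →ₗ[ℚ] V)),
      Function.Injective rep ∧ (∀ c, cl (rep c) = c) ∧
      (∀ (c c' : Fin n) (P : V →ₗ[ℚ] V), c ≠ c' → (∀ v ∈ N (rep c), P v ∈ N (rep c')) →
        (∀ v ∈ N (rep c), P v = 0 → v = 0) →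
        (∀ (i : ι) (v : V), v ∈ N (rep c) → P (T i v) = T i (P v)) → False) ∧
      ∀ s, (∀ v ∈ N (rep (cl s)), L s v ∈ N s) ∧ (∀ v ∈ N (rep (cl s)), L s v = 0 → v = 0) ∧
        (∀ v' ∈ N s, ∃ v ∈ N (rep (cl s)), L s v = v') ∧
        ∀ (i : ι) (v : V), v ∈ N (rep (cl s)) → L s (T i v) = T i (L s v) := by
  -- admissible sub-sets: pairwise non-isomorphic members
  let adm : Finset σ → Prop := fun R => ∀ r ∈ R, ∀ r' ∈ R, r ≠ r' → ∀ P : V →ₗ[ℚ] V,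
    (∀ v ∈ N r, P v ∈ N r') → (∀ v ∈ N r, P v = 0 → v = 0) → (∀ v' ∈ N r', ∃ v ∈ N r, P v = v') →
    (∀ (i : ι) (v : V), v ∈ N r → P (T i v) = T i (P v)) → False
  obtain ⟨R, hRmem, hRmax⟩ := Finset.exists_max_image (Finset.univ.filter adm) Finset.card
    ⟨∅, Finset.mem_filter.2 ⟨Finset.mem_univ _, fun r hr => absurd hr (Finset.notMem_empty r)⟩⟩
  have hR : adm R := (Finset.mem_filter.1 hRmem).2
  -- every member is isomorphic to a member of `R`
  have hcov : ∀ s, ∃ r ∈ R, ∃ P : V →ₗ[ℚ] V, (∀ v ∈ N r, P v ∈ N s) ∧ (∀ v ∈ N r, P v = 0 → v = 0) ∧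
      (∀ v' ∈ N s, ∃ v ∈ N r, P v = v') ∧ ∀ (i : ι) (v : V), v ∈ N r → P (T i v) = T i (P v) := by
    intro s
    by_contra hs
    have hsR : s ∉ R := fun hsR =>
      hs ⟨s, hsR, LinearMap.id, iso_refl T (N s)⟩
    have hadm : adm (insert s R) := by
      intro r hr r' hr' hne P h1 h2 h3 h4
      rcases Finset.mem_insert.1 hr with hrs | hrR
      · subst hrs
        rcases Finset.mem_insert.1 hr' with hr's | hr'R
        · exact hne hr's.symm
        · -- `N s ≅ N r'`: invert
          obtain ⟨P', h1', h2', h3', h4', -, -⟩ := exists_inverse_of_iso T P (hNst _) h1 h2 h3 h4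
          exact hs ⟨r', hr'R, P', h1', h2', h3', h4'⟩
      · rcases Finset.mem_insert.1 hr' with hr's | hr'R
        · subst hr's
          exact hs ⟨r, hrR, P, h1, h2, h3, h4⟩
        · exact hR r hrR r' hr'R hne P h1 h2 h3 h4
    have hle := hRmax (insert s R) (Finset.mem_filter.2 ⟨Finset.mem_univ _, hadm⟩)
    rw [Finset.card_insert_of_notMem hsR] at hle
    exact Nat.not_succ_le_self _ hle
  choose r hrR P hP1 hP2 hP3 hP4 using hcov
  -- the representative of a member of `R` is itself
  have huniq : ∀ s ∈ R, r s = s := fun s hs => by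
    by_contra hne
    exact hR (r s) (hrR s) s hs hne (P s) (hP1 s) (hP2 s) (hP3 s) (hP4 s)
  -- enumerate `R`
  let ε := R.equivFin
  refine ⟨R.card, fun c => (ε.symm c).1, fun s => ε ⟨r s, hrR s⟩, P,
    fun c c' h => ε.symm.injective (Subtype.ext h), fun c => ?_, fun c c' Q hcc' h1 h2 h4 => ?_, fun s => ?_⟩
  · have h : (⟨r (ε.symm c).1, hrR _⟩ : R) = ε.symm c := Subtype.ext (huniq _ (ε.symm c).2)
    show ε ⟨r (ε.symm c).1, hrR _⟩ = c
    rw [h, Equiv.apply_symm_apply]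
  · have hne : (ε.symm c).1 ≠ (ε.symm c').1 := fun h => hcc' (ε.symm.injective (Subtype.ext h))
    have h3 := onto_of_embed_of_irreducible T Q (hNst _) (hN0 _) (hNirr _) h1 h2 h4
    exact hR _ (ε.symm c).2 _ (ε.symm c').2 hne Q h1 h2 h3 h4
  · have h : (ε.symm (ε ⟨r s, hrR s⟩)).1 = r s := by rw [Equiv.symm_apply_apply]
    beta_reduce
    rw [h]
    exact ⟨hP1 s, hP2 s, hP3 s, hP4 s⟩

/-- **EVERY MEMBER IS ISOMORPHIC TO EXACTLY ONE REPRESENTATIVE**: with the data of `exists_representatives`, an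
equivariant embedding `N_{rep c} → N_s` forces `c = cl s` (compose with `L_s⁻¹` and use the separation of the
representatives).  Stated for any `rep`, `cl`, `L` with the three properties. [cite: Serre1977, §2.6] -/
theorem eq_cl_of_embed {σ : Type u} {N : σ → Submodule ℚ V}
    (hNst : ∀ (s : σ) (i : ι) (v : V), v ∈ N s → T i v ∈ N s)
    {n : ℕ} {rep : Fin n → σ} {cl : σ → Fin n} {L : σ → (V →ₗ[ℚ] V)}
    (hsep : ∀ (c c' : Fin n) (P : V →ₗ[ℚ] V), c ≠ c' → (∀ v ∈ N (rep c), P v ∈ N (rep c')) →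
      (∀ v ∈ N (rep c), P v = 0 → v = 0) →
      (∀ (i : ι) (v : V), v ∈ N (rep c) → P (T i v) = T i (P v)) → False)
    (hL : ∀ s, (∀ v ∈ N (rep (cl s)), L s v ∈ N s) ∧ (∀ v ∈ N (rep (cl s)), L s v = 0 → v = 0) ∧
      (∀ v' ∈ N s, ∃ v ∈ N (rep (cl s)), L s v = v') ∧
      ∀ (i : ι) (v : V), v ∈ N (rep (cl s)) → L s (T i v) = T i (L s v))
    {c : Fin n} {s : σ} (Q : V →ₗ[ℚ] V) (hQN : ∀ v ∈ N (rep c), Q v ∈ N s)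
    (hQinj : ∀ v ∈ N (rep c), Q v = 0 → v = 0)
    (hQeq : ∀ (i : ι) (v : V), v ∈ N (rep c) → Q (T i v) = T i (Q v)) : c = cl s := by
  by_contra hne
  obtain ⟨h1, h2, h3, h4⟩ := hL s
  obtain ⟨L', h1', h2', -, h4', -, -⟩ := exists_inverse_of_iso T (L s) (hNst _) h1 h2 h3 h4
  refine hsep c (cl s) (L' ∘ₗ Q) hne (fun v hv => h1' _ (hQN v hv))
    (fun v hv h => hQinj v hv (h2' _ (hQN v hv) h)) fun i v hv => ?_
  rw [LinearMap.comp_apply, LinearMap.comp_apply, hQeq i v hv, h4' i _ (hQN v hv)]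

end Summit.HodgeConjecture.CorCM.IrrOdd

end
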